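import Summits.CriticalPhenomena.PercolationContinuityZ3.Theorems.PercNearOneGluingNoHeavyLowerTailSahiCTCStrongTwistedKleitmanChain

/-!
# `NoHeavyLowerTail` (crux stmt-CriticalPhenomena-4575), P3 lane: the splice chain (STK_s) for GAP-CLOSED families

Support file (seat `prim-l12-p3`, gen 38; `--supports stmt-CriticalPhenomena-4575`).  Memo
`run/shared/lean/prim/prim-l12/FROM-prim-l12-p3-g38-ENTANGLEMENT.md` §9 (the gap-transport conjecture: the ordered forms Φ(s,u), s ≤ u, are
conjectured nonnegative for every `s`-gap-closed first argument, a class strictly larger than up-sets and closed under coordinate peeling).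
gen 36 proved the chain `N_s ≤ N_{s+1}` (`…SahiCTCStrongTwistedKleitman[Chain]`) for monotone `A, B`.  Here `A` is only assumed `t`-gap-closed
(closed under inserting an element below its `t`-th smallest one, any insertion while `#S < t`) and the chain is proved for all `s < t`;
`B` stays monotone.  So in the gap class too `Φ(t,t) = STK + Δ` with `STK ≥ 0` a theorem.  Nothing is asserted about the crux.
-/

namespace Summit.CriticalPhenomena.PercolationContinuityZ3.Theorems

namespace SahiCTCStrongTwistedKleitmanGap

open Finset SahiCTCStrongTwistedKleitman

variable {α : Type*} [LinearOrder α]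

/-- **THE SPLICE CHAIN IS MONOTONE FOR GAP-CLOSED FAMILIES** (memo g38 §9.3): let `s < t`.  If `B` is monotone and `A` is
`t`-GAP-CLOSED on `V` — `A S → A (insert a S)` whenever `S ⊆ V`, `a ∈ V \ S` and fewer than `t` elements of `S` lie below `a` (i.e. `a` is
inserted below the `t`-th smallest element of `S`, or `#S < t`; every monotone `A` qualifies) — then for disjoint `C, R` with `C ∪ R = V`
`#{W ⊆ R : A x ∧ B (ψ̃_s(x,y))} ≤ #{W ⊆ R : A x ∧ B (ψ̃_{s+1}(x,y))}` (`x = C ∪ W`, `y = C ∪ (R \ W)`): the chain `N_0 ≤ N_1 ≤ … ≤ N_t` of gen 36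
holds in the larger class (up to level `t`; it can fail at level `t+1`).  Proof: gen 36's max-coordinate induction verbatim; the hypothesis is
inherited by the sections `A ∘ insert n` (n the current maximum), and the only pointwise use of monotonicity of `A` is the insertion of the
maximum into a set of size exactly `s < t`. [this work] -/
theorem card_splice_le_card_splice_succ_gap (s t : ℕ) (hst : s < t) (V : Finset α) :
    ∀ (A B : Finset α → Prop) [DecidablePred A] [DecidablePred B],
      (∀ S : Finset α, S ⊆ V → ∀ a ∈ V, a ∉ S → (S.filter fun w => w < a).card < t → A S → A (insert a S)) →
      (∀ S T : Finset α, S ⊆ T → B S → B T) →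
      ∀ (C R : Finset α), Disjoint C R → C ∪ R = V →
        (R.powerset.filter fun W => A (C ∪ W) ∧
          B (((C ∪ W).filter fun v => ((C ∪ W).filter fun w => w ≤ v).card ≤ s) ∪
             ((C ∪ (R \ W)).filter fun v => s ≤ ((C ∪ W).filter fun w => w < v).card))).card ≤
        (R.powerset.filter fun W => A (C ∪ W) ∧
          B (((C ∪ W).filter fun v => ((C ∪ W).filter fun w => w ≤ v).card ≤ s + 1) ∪
             ((C ∪ (R \ W)).filter fun v => s + 1 ≤ ((C ∪ W).filter fun w => w < v).card))).card := by
  induction V using Finset.induction_on_max with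
  | empty =>
    intro A B _ _ _ _ C R _ hCR
    obtain ⟨rfl, rfl⟩ := union_eq_empty.mp hCR
    apply le_of_eq
    apply congrArg Finset.card
    apply filter_congr
    intro W hW
    rw [powerset_empty, mem_singleton] at hW
    subst hW
    simp
  | insert n V' hlt ih =>
    intro A B _ _ hA hB C R hdis hCR
    have hnV' : n ∉ V' := fun h => lt_irrefl n (hlt n h)
    have hn : n ∈ C ∪ R := by rw [hCR]; exact mem_insert_self n V'
    rcases mem_union.mp hn with hnC | hnR
    · have hnR : n ∉ R := fun h => disjoint_left.mp hdis hnC h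
      set C' := C.erase n with hC'_def
      have hC : C = insert n C' := by rw [hC'_def, insert_erase hnC]
      have hnC' : n ∉ C' := by rw [hC'_def]; exact notMem_erase n C
      have hdis' : Disjoint C' R := disjoint_of_subset_left (erase_subset n C) hdis
      have hCR' : C' ∪ R = V' := by
        have : (C ∪ R).erase n = (insert n V').erase n := by rw [hCR]
        rwa [erase_insert hnV', hC, insert_union, erase_insert] at this
        rw [mem_union, not_or]; exact ⟨hnC', hnR⟩
      have hsub : ∀ W : Finset α, W ⊆ R → ∀ w ∈ C' ∪ W, w < n := fun W hW w hw => by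
        apply hlt; rw [← hCR']; rcases mem_union.mp hw with h | h
        · exact mem_union_left _ h
        · exact mem_union_right _ (hW h)
      -- the gap hypothesis is inherited by the section `A ∘ insert n` (n lies above everything in V')
      have hA1 : ∀ S : Finset α, S ⊆ V' → ∀ a ∈ V', a ∉ S → (S.filter fun w => w < a).card < t →
          A (insert n S) → A (insert n (insert a S)) := by
        intro S hS a haV haS hc h
        have han : a < n := hlt a haV
        have hnS : n ∉ S := fun h' => hnV' (hS h')
        rw [Finset.insert_comm]
        refine hA (insert n S) (insert_subset_insert n hS) a (mem_insert_of_mem haV) ?_ ?_ h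
        · rw [mem_insert, not_or]; exact ⟨ne_of_lt han, haS⟩
        · rw [filter_insert, if_neg (not_lt.mpr (le_of_lt han))]; exact hc
      have IH := ih (fun S => A (insert n S)) (fun S => B (insert n S))
        hA1 (fun S T hST h => hB _ _ (insert_subset_insert n hST) h)
        C' R hdis' hCR'
      have eL : (R.powerset.filter fun W => A (C ∪ W) ∧
            B (((C ∪ W).filter fun v => ((C ∪ W).filter fun w => w ≤ v).card ≤ s) ∪
              ((C ∪ (R \ W)).filter fun v => s ≤ ((C ∪ W).filter fun w => w < v).card))) =
          R.powerset.filter fun W => A (insert n (C' ∪ W)) ∧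
            B (insert n (((C' ∪ W).filter fun v => ((C' ∪ W).filter fun w => w ≤ v).card ≤ s) ∪
              ((C' ∪ (R \ W)).filter fun v => s ≤ ((C' ∪ W).filter fun w => w < v).card))) := by
        apply filter_congr; intro W hW
        rw [hC, insert_union, insert_union,
          splice_insert_both s (hsub W (mem_powerset.mp hW)) (hsub (R \ W) sdiff_subset)]
      have eR : (R.powerset.filter fun W => A (C ∪ W) ∧
            B (((C ∪ W).filter fun v => ((C ∪ W).filter fun w => w ≤ v).card ≤ s + 1) ∪
              ((C ∪ (R \ W)).filter fun v => s + 1 ≤ ((C ∪ W).filter fun w => w < v).card))) =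
          R.powerset.filter fun W => A (insert n (C' ∪ W)) ∧
            B (insert n (((C' ∪ W).filter fun v => ((C' ∪ W).filter fun w => w ≤ v).card ≤ s + 1) ∪
              ((C' ∪ (R \ W)).filter fun v => s + 1 ≤ ((C' ∪ W).filter fun w => w < v).card))) := by
        apply filter_congr; intro W hW
        rw [hC, insert_union, insert_union,
          splice_insert_both (s + 1) (hsub W (mem_powerset.mp hW)) (hsub (R \ W) sdiff_subset)]
      rw [eL, eR]
      exact IH
    · have hnC : n ∉ C := fun h => disjoint_left.mp hdis h hnR
      set R' := R.erase n with hR'_def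
      have hR : R = insert n R' := by rw [hR'_def, insert_erase hnR]
      have hnR' : n ∉ R' := by rw [hR'_def]; exact notMem_erase n R
      have hdis' : Disjoint C R' := disjoint_of_subset_right (erase_subset n R) hdis
      have hCR' : C ∪ R' = V' := by
        have : (C ∪ R).erase n = (insert n V').erase n := by rw [hCR]
        rwa [erase_insert hnV', hR, union_insert, erase_insert] at this
        rw [mem_union, not_or]; exact ⟨hnC, hnR'⟩
      have hsubx : ∀ W : Finset α, W ⊆ R' → ∀ w ∈ C ∪ W, w < n := fun W hW w hw => by
        apply hlt; rw [← hCR']; rcases mem_union.mp hw with h | h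
        · exact mem_union_left _ h
        · exact mem_union_right _ (hW h)
      have hA0 : ∀ S : Finset α, S ⊆ V' → ∀ a ∈ V', a ∉ S → (S.filter fun w => w < a).card < t → A S → A (insert a S) :=
        fun S hS a haV haS hc h => hA S (hS.trans (subset_insert n V')) a (mem_insert_of_mem haV) haS hc h
      have hA1 : ∀ S : Finset α, S ⊆ V' → ∀ a ∈ V', a ∉ S → (S.filter fun w => w < a).card < t →
          A (insert n S) → A (insert n (insert a S)) := by
        intro S hS a haV haS hc h
        have han : a < n := hlt a haV
        have hnS : n ∉ S := fun h' => hnV' (hS h')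
        rw [Finset.insert_comm]
        refine hA (insert n S) (insert_subset_insert n hS) a (mem_insert_of_mem haV) ?_ ?_ h
        · rw [mem_insert, not_or]; exact ⟨ne_of_lt han, haS⟩
        · rw [filter_insert, if_neg (not_lt.mpr (le_of_lt han))]; exact hc
      have IH01 := ih A (fun S => B (insert n S)) hA0 (fun S T hST h => hB _ _ (insert_subset_insert n hST) h) C R' hdis' hCR'
      have IH10 := ih (fun S => A (insert n S)) B hA1 hB C R' hdis' hCR'
      rw [hR, powerset_insert]
      have hdisj : Disjoint R'.powerset (R'.powerset.image (insert n)) := by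
        rw [disjoint_left]
        intro W hW hW'
        rw [mem_image] at hW'
        obtain ⟨W', _, rfl⟩ := hW'
        exact hnR' (mem_powerset.mp hW (mem_insert_self n W'))
      rw [filter_union, filter_union, card_union_of_disjoint (disjoint_filter_filter hdisj),
        card_union_of_disjoint (disjoint_filter_filter hdisj)]
      have hinj : Set.InjOn (insert n) (R'.powerset : Set (Finset α)) := by
        intro W₁ hW₁ W₂ hW₂ h
        have h1 : n ∉ W₁ := fun hh => hnR' (mem_powerset.mp (mem_coe.mp hW₁) hh)
        have h2 : n ∉ W₂ := fun hh => hnR' (mem_powerset.mp (mem_coe.mp hW₂) hh)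
        rw [← erase_insert h1, ← erase_insert h2, h]
      -- the four pieces, for level s (L) and level s+1 (R)
      have p0L : (R'.powerset.filter fun W => A (C ∪ W) ∧
            B (((C ∪ W).filter fun v => ((C ∪ W).filter fun w => w ≤ v).card ≤ s) ∪
              ((C ∪ (insert n R' \ W)).filter fun v => s ≤ ((C ∪ W).filter fun w => w < v).card))) =
          R'.powerset.filter fun W => A (C ∪ W) ∧
            B (if s ≤ (C ∪ W).card then
                insert n (((C ∪ W).filter fun v => ((C ∪ W).filter fun w => w ≤ v).card ≤ s) ∪
                  ((C ∪ (R' \ W)).filter fun v => s ≤ ((C ∪ W).filter fun w => w < v).card))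
               else (((C ∪ W).filter fun v => ((C ∪ W).filter fun w => w ≤ v).card ≤ s) ∪
                  ((C ∪ (R' \ W)).filter fun v => s ≤ ((C ∪ W).filter fun w => w < v).card))) := by
        apply filter_congr; intro W hW
        have hW' := mem_powerset.mp hW
        rw [insert_sdiff_of_notMem R' (fun h => hnR' (hW' h)), union_insert,
          splice_insert_right s (hsubx W hW') (hsubx (R' \ W) sdiff_subset)]
      have p0R : (R'.powerset.filter fun W => A (C ∪ W) ∧
            B (((C ∪ W).filter fun v => ((C ∪ W).filter fun w => w ≤ v).card ≤ s + 1) ∪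
              ((C ∪ (insert n R' \ W)).filter fun v => s + 1 ≤ ((C ∪ W).filter fun w => w < v).card))) =
          R'.powerset.filter fun W => A (C ∪ W) ∧
            B (if s + 1 ≤ (C ∪ W).card then
                insert n (((C ∪ W).filter fun v => ((C ∪ W).filter fun w => w ≤ v).card ≤ s + 1) ∪
                  ((C ∪ (R' \ W)).filter fun v => s + 1 ≤ ((C ∪ W).filter fun w => w < v).card))
               else (((C ∪ W).filter fun v => ((C ∪ W).filter fun w => w ≤ v).card ≤ s + 1) ∪
                  ((C ∪ (R' \ W)).filter fun v => s + 1 ≤ ((C ∪ W).filter fun w => w < v).card))) := by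
        apply filter_congr; intro W hW
        have hW' := mem_powerset.mp hW
        rw [insert_sdiff_of_notMem R' (fun h => hnR' (hW' h)), union_insert,
          splice_insert_right (s + 1) (hsubx W hW') (hsubx (R' \ W) sdiff_subset)]
      have p1L : ((R'.powerset.image (insert n)).filter fun W => A (C ∪ W) ∧
            B (((C ∪ W).filter fun v => ((C ∪ W).filter fun w => w ≤ v).card ≤ s) ∪
              ((C ∪ (insert n R' \ W)).filter fun v => s ≤ ((C ∪ W).filter fun w => w < v).card))).card =
          (R'.powerset.filter fun W => A (insert n (C ∪ W)) ∧
            B (if (C ∪ W).card + 1 ≤ s then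
                insert n (((C ∪ W).filter fun v => ((C ∪ W).filter fun w => w ≤ v).card ≤ s) ∪
                  ((C ∪ (R' \ W)).filter fun v => s ≤ ((C ∪ W).filter fun w => w < v).card))
               else (((C ∪ W).filter fun v => ((C ∪ W).filter fun w => w ≤ v).card ≤ s) ∪
                  ((C ∪ (R' \ W)).filter fun v => s ≤ ((C ∪ W).filter fun w => w < v).card)))).card := by
        rw [filter_image, card_image_of_injOn (fun x hx y hy h => hinj (mem_coe.mpr (mem_filter.mp (mem_coe.mp hx)).1)
          (mem_coe.mpr (mem_filter.mp (mem_coe.mp hy)).1) h)]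
        congr 1
        apply filter_congr; intro W hW
        have hW' := mem_powerset.mp hW
        rw [insert_sdiff_insert, sdiff_insert_of_notMem hnR', union_insert,
          splice_insert_left s (hsubx W hW') (hsubx (R' \ W) sdiff_subset)]
      have p1R : ((R'.powerset.image (insert n)).filter fun W => A (C ∪ W) ∧
            B (((C ∪ W).filter fun v => ((C ∪ W).filter fun w => w ≤ v).card ≤ s + 1) ∪
              ((C ∪ (insert n R' \ W)).filter fun v => s + 1 ≤ ((C ∪ W).filter fun w => w < v).card))).card =
          (R'.powerset.filter fun W => A (insert n (C ∪ W)) ∧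
            B (if (C ∪ W).card + 1 ≤ s + 1 then
                insert n (((C ∪ W).filter fun v => ((C ∪ W).filter fun w => w ≤ v).card ≤ s + 1) ∪
                  ((C ∪ (R' \ W)).filter fun v => s + 1 ≤ ((C ∪ W).filter fun w => w < v).card))
               else (((C ∪ W).filter fun v => ((C ∪ W).filter fun w => w ≤ v).card ≤ s + 1) ∪
                  ((C ∪ (R' \ W)).filter fun v => s + 1 ≤ ((C ∪ W).filter fun w => w < v).card)))).card := by
        rw [filter_image, card_image_of_injOn (fun x hx y hy h => hinj (mem_coe.mpr (mem_filter.mp (mem_coe.mp hx)).1)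
          (mem_coe.mpr (mem_filter.mp (mem_coe.mp hy)).1) h)]
        congr 1
        apply filter_congr; intro W hW
        have hW' := mem_powerset.mp hW
        rw [insert_sdiff_insert, sdiff_insert_of_notMem hnR', union_insert,
          splice_insert_left (s + 1) (hsubx W hW') (hsubx (R' \ W) sdiff_subset)]
      rw [p0L, p0R, p1L, p1R]
      -- pointwise: (L0+L1) + (IH right sides) ≤ (R0+R1) + (IH left sides); then add the two IH inequalities
      rw [card_filter, card_filter] at IH01 IH10
      rw [card_filter, card_filter, card_filter, card_filter]
      have key : ∀ W ∈ R'.powerset,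
          ((if A (C ∪ W) ∧ B (if s ≤ (C ∪ W).card then
                insert n (((C ∪ W).filter fun v => ((C ∪ W).filter fun w => w ≤ v).card ≤ s) ∪
                  ((C ∪ (R' \ W)).filter fun v => s ≤ ((C ∪ W).filter fun w => w < v).card))
               else (((C ∪ W).filter fun v => ((C ∪ W).filter fun w => w ≤ v).card ≤ s) ∪
                  ((C ∪ (R' \ W)).filter fun v => s ≤ ((C ∪ W).filter fun w => w < v).card))) then 1 else 0) +
           (if A (insert n (C ∪ W)) ∧ B (if (C ∪ W).card + 1 ≤ s then
                insert n (((C ∪ W).filter fun v => ((C ∪ W).filter fun w => w ≤ v).card ≤ s) ∪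
                  ((C ∪ (R' \ W)).filter fun v => s ≤ ((C ∪ W).filter fun w => w < v).card))
               else (((C ∪ W).filter fun v => ((C ∪ W).filter fun w => w ≤ v).card ≤ s) ∪
                  ((C ∪ (R' \ W)).filter fun v => s ≤ ((C ∪ W).filter fun w => w < v).card))) then 1 else 0)) +
          ((if A (C ∪ W) ∧ B (insert n (((C ∪ W).filter fun v => ((C ∪ W).filter fun w => w ≤ v).card ≤ s + 1) ∪
                  ((C ∪ (R' \ W)).filter fun v => s + 1 ≤ ((C ∪ W).filter fun w => w < v).card))) then 1 else 0) +
           (if A (insert n (C ∪ W)) ∧ B (((C ∪ W).filter fun v => ((C ∪ W).filter fun w => w ≤ v).card ≤ s + 1) ∪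
                  ((C ∪ (R' \ W)).filter fun v => s + 1 ≤ ((C ∪ W).filter fun w => w < v).card)) then 1 else 0)) ≤
          ((if A (C ∪ W) ∧ B (if s + 1 ≤ (C ∪ W).card then
                insert n (((C ∪ W).filter fun v => ((C ∪ W).filter fun w => w ≤ v).card ≤ s + 1) ∪
                  ((C ∪ (R' \ W)).filter fun v => s + 1 ≤ ((C ∪ W).filter fun w => w < v).card))
               else (((C ∪ W).filter fun v => ((C ∪ W).filter fun w => w ≤ v).card ≤ s + 1) ∪
                  ((C ∪ (R' \ W)).filter fun v => s + 1 ≤ ((C ∪ W).filter fun w => w < v).card))) then 1 else 0) +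
           (if A (insert n (C ∪ W)) ∧ B (if (C ∪ W).card + 1 ≤ s + 1 then
                insert n (((C ∪ W).filter fun v => ((C ∪ W).filter fun w => w ≤ v).card ≤ s + 1) ∪
                  ((C ∪ (R' \ W)).filter fun v => s + 1 ≤ ((C ∪ W).filter fun w => w < v).card))
               else (((C ∪ W).filter fun v => ((C ∪ W).filter fun w => w ≤ v).card ≤ s + 1) ∪
                  ((C ∪ (R' \ W)).filter fun v => s + 1 ≤ ((C ∪ W).filter fun w => w < v).card))) then 1 else 0)) +
          ((if A (C ∪ W) ∧ B (insert n (((C ∪ W).filter fun v => ((C ∪ W).filter fun w => w ≤ v).card ≤ s) ∪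
                  ((C ∪ (R' \ W)).filter fun v => s ≤ ((C ∪ W).filter fun w => w < v).card))) then 1 else 0) +
           (if A (insert n (C ∪ W)) ∧ B (((C ∪ W).filter fun v => ((C ∪ W).filter fun w => w ≤ v).card ≤ s) ∪
                  ((C ∪ (R' \ W)).filter fun v => s ≤ ((C ∪ W).filter fun w => w < v).card)) then 1 else 0)) := by
        intro W hW
        have hW' := mem_powerset.mp hW
        have ha : (C ∪ W).card = s → (A (C ∪ W) → A (insert n (C ∪ W))) := by
          intro hcs
          have hlt2 : ∀ w ∈ C ∪ W, w < n := hsubx W hW'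
          have hnCW : n ∉ C ∪ W := fun h => lt_irrefl n (hlt2 n h)
          have hsubV : C ∪ W ⊆ insert n V' := by
            rw [← hCR']; exact (union_subset_union (subset_refl C) hW').trans (subset_insert n _)
          refine hA (C ∪ W) hsubV n (mem_insert_self n V') hnCW ?_
          rw [filter_true_of_mem hlt2, hcs]; exact hst
        rcases Nat.lt_trichotomy (C ∪ W).card s with hlt' | heq | hgt
        · -- below level s: both splices are x' itself
          have h1 : ¬ (s ≤ (C ∪ W).card) := by omega
          have h2 : (C ∪ W).card + 1 ≤ s := by omega
          have h3 : ¬ (s + 1 ≤ (C ∪ W).card) := by omega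
          have h4 : (C ∪ W).card + 1 ≤ s + 1 := by omega
          rw [if_neg h1, if_pos h2, if_neg h3, if_pos h4,
            splice_eq_self_of_card_lt s hlt', splice_eq_self_of_card_lt (s + 1) (by omega)]
        · -- exactly level s: the remainder (a₁ − a₀)(b₁ − b₀) at Q = ψ̃_{s+1}
          have h1 : s ≤ (C ∪ W).card := by omega
          have h2 : ¬ ((C ∪ W).card + 1 ≤ s) := by omega
          have h3 : ¬ (s + 1 ≤ (C ∪ W).card) := by omega
          have h4 : (C ∪ W).card + 1 ≤ s + 1 := by omega
          rw [if_pos h1, if_neg h2, if_neg h3, if_pos h4]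
          have hx := ite_cross_le (A (C ∪ W)) (A (insert n (C ∪ W)))
            (B (((C ∪ W).filter fun v => ((C ∪ W).filter fun w => w ≤ v).card ≤ s + 1) ∪
                  ((C ∪ (R' \ W)).filter fun v => s + 1 ≤ ((C ∪ W).filter fun w => w < v).card)))
            (B (insert n (((C ∪ W).filter fun v => ((C ∪ W).filter fun w => w ≤ v).card ≤ s + 1) ∪
                  ((C ∪ (R' \ W)).filter fun v => s + 1 ≤ ((C ∪ W).filter fun w => w < v).card))))
            (ha heq) (hB _ _ (subset_insert n _))
          omega
        · -- above level s: everything matches the IH pieces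
          have h1 : s ≤ (C ∪ W).card := by omega
          have h2 : ¬ ((C ∪ W).card + 1 ≤ s) := by omega
          have h3 : s + 1 ≤ (C ∪ W).card := by omega
          have h4 : ¬ ((C ∪ W).card + 1 ≤ s + 1) := by omega
          rw [if_pos h1, if_neg h2, if_pos h3, if_neg h4]
          omega
      have hsum := sum_le_sum key
      rw [sum_add_distrib, sum_add_distrib, sum_add_distrib, sum_add_distrib, sum_add_distrib, sum_add_distrib] at hsum
      omega

/-- Monotone predicates are `t`-gap-closed on every `V`, so `card_splice_le_card_splice_succ_gap` contains gen 36's chain for `s < t`.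
[this work] -/
theorem gapClosed_of_monotone (t : ℕ) (V : Finset α) (A : Finset α → Prop) (hA : ∀ S T : Finset α, S ⊆ T → A S → A T) :
    ∀ S : Finset α, S ⊆ V → ∀ a ∈ V, a ∉ S → (S.filter fun w => w < a).card < t → A S → A (insert a S) :=
  fun S _ a _ _ _ h => hA S (insert a S) (subset_insert a S) h

end SahiCTCStrongTwistedKleitmanGap

end Summit.CriticalPhenomena.PercolationContinuityZ3.Theorems
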